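import Summits.Ventures.CertifiedManyBodySolver.Downfold.TPrimePinnedPairRowKernel
import Summits.Ventures.CertifiedManyBodySolver.Rows.CorrWindowCertKernelPoly
import HarnessLib

/-!
# The PINNED t′-PAIR shape from TWO certificates with SEMANTIC residual polynomials sharing ONE equation-of-motion word list:
# `SquareTTPrimePinnedPairRowT.of_residPolys` — the entry point of the pair path for STAGED (chunked) kernel replays
# (cell `pub/hubbard-obs` × `pub/hubbard-downfold`, D-0154 (1)(C) COVERAGE La214; seat `hubbard-cov-la214-unc-2`, lineage desk; zero compute)

HONEST FRAMING: Lean plumbing towards «tier P» for PAIR claim nodes‴; the semantic-residual twin of `Downfold/TPrimePinnedPairRowKernelCert.lean`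
(p668982), composing hubbard-obs-p2's `CARPolyWindow.windowIdentity_of_residPoly` (`Rows/CorrWindowCertKernelPoly.lean`, p669665) with this base's
identity-level pair link `SquareTTPrimePinnedPairRowT.of_windowIdentities` (p665976). WHY: hubbard-obs-p2 measured that one `decide +kernel`
declaration holds a normal form of at most ≈ 10⁴ monomials, so no La214 certificate (CORE: ≈ 1.6·10⁷ word-pair terms) passes the ONE-SHOT hypothesis
`normalize enc B (residTG …) = R` of p668982; the residual is consumed slice by slice by an encoded merge CHAIN whose decoded end is a polynomial `R`
with `evalPoly d R = termOp d (residTG …)` — exactly the hypothesis `hR_v` below. Nothing is asserted: no `def`, no named fact, no `sorry`, no number;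
no claim node is discharged (that needs the exporter + the chain evaluations); CONTROL / CALIBRATION wording class (xx1); no summit statement is
proved by this file.

References: J. Wang et al., PRX 14 (2024) 031006 §III [WangEtAl2024]; X. Han, arXiv:2006.06002 §3 [Han2020Bootstrap]; C. Jansson, D. Chaykin,
C. Keil, SIAM J. Numer. Anal. 46 (2008) 180 [JanssonChaykinKeil2008]; D. P. Bertsekas, *Nonlinear Programming* (1999) Prop. 5.1.3
[Bertsekas1999NonlinearProgramming]; S. Boyd, L. Vandenberghe, *Convex Optimization* (2004) §5.9 [BoydVandenberghe2004].
-/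

noncomputable section

namespace Summit.Ventures.CertifiedManyBodySolver.Downfold

open Literature.MathematicalPhysics.QuantumLattice
open Matrix HubbardWave0 Literature.Probability.LatticeModels ThermodynamicLimit Filter Topology
open Literature.MathematicalPhysics.QuantumManyBody.StateRelaxation
open Summit.Ventures.CertifiedQuantumChemistry Summit.Ventures.CertifiedQuantumChemistry.CARPoly
open Summit.Ventures.CertifiedManyBodySolver.CARPolyWindow
open scoped BigOperators ComplexOrder

/-! ## §1  TWO certificates with SEMANTIC residual polynomials and ONE shared eom word list ⇒ the pinned t′-pair shape -/

section KernelPairPoly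

variable {α β : Type*}

/-- **KERNEL FORM OF THE PAIR NODE‴, SEMANTIC RESIDUALS (the entry point for STAGED kernel replays).** As
`SquareTTPrimePinnedPairRowT.of_kernelCerts` (p668982) but with, per vertex, ANY polynomial `R_v` that DENOTES the residual —
`hR_v : evalPoly d R_v = termOp d (residTG TX_v μ_v ν_v o κ_v cap_v κ_v' fl_v TE_v TG_v TH_v f EB g_v SY_v CW_v AV_v)` — instead of the
one-shot collected normal form (which no real La214 certificate passes in ONE `decide +kernel` call: hubbard-obs-p2's measurement, ≈ 10⁴ monomials
per declaration); the decoded end of an encoded merge CHAIN (`Rows/CorrWindowCertKernelChain.lean`, one `decide +kernel` per slice) or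
`normalize` itself (`evalPoly_normalize'`) both discharge `hR_v`. No injectivity / encoding hypothesis is needed at this level. The price is still
`lowerConst R_v` (`constCoeff_sub_sum_norm_resCoeff`, valid for any polynomial). [cite: WangEtAl2024, §III] [cite: JanssonChaykinKeil2008, §3]
[cite: Bertsekas1999NonlinearProgramming, Prop. 5.1.3] -/
theorem SquareTTPrimePinnedPairRowT.of_residPolys
    (U : ℚ) (hU : 0 ≤ U) (n₀ : ℚ) (hn0 : 0 ≤ n₀) (hn2 : n₀ < 2) (sA sB : ℚ)
    {Λ : Finset (Site 2)} (hΛ : Λ ⊆ box 2 7) (h8 : thicken Λ 1 ⊆ box 2 7)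
    (h0 : thicken ({0} : Finset (Site 2)) 1 ⊆ box 2 7) (hz : (0 : Site 2) ∈ box 2 7)
    -- letters (shared)
    (d : α → Orb (PolySite (box 2 7)))
    (dΛ : β → Orb (PolySite Λ)) (f : β → α) (hf : ∀ b, d (f b) = Orb.embMap (PolySite.incl hΛ) (dΛ b))
    (sp : α → Fin 2) (hsp : ∀ a, (ofLex (d a)).2 = sp a)
    (o : Fin 2 → α) (ho : ∀ σ, d (o σ) = orb (PolySite.pt 0 hz) σ)
    -- the objective family and the SHARED eom words
    (X : ℝ → FermionOp (box 2 7)) (EB : List (Terms β))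
    -- vertex A
    (THA : Terms α) (hHA : termOp d THA = (hubbardTTPrimeFermionInteraction 1 (sA : ℝ) (U : ℝ)).localHamiltonian (box 2 7))
    (TEA : Terms α)
    (hEA : termOp d TEA = fermionEmbed (PolySite.incl h0) ((hubbardTTPrimeFermionInteraction 1 (sA : ℝ) (U : ℝ)).meanEnergyObs 1))
    (TXA : Terms α) (hXA : termOp d TXA = X (sA : ℝ)) (μA : Fin 2 → ℚ) (νA κA capA κA' flA : ℚ)
    (TGA : Terms α) {mA : Type*} [Fintype mA] [DecidableEq mA] {ΛmA : Matrix mA mA ℂ} (hΛmA : ΛmA.PosSemidef)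
    (OA : mA → FermionOp (box 2 7)) (hGA : termOp d TGA = gramForm ΛmA OA)
    {nSA : ℕ} (γA : Fin nSA → DihedralGroup 4) (wvA : Fin nSA → Site 2) (hshA : ∀ l, d4ShiftSet (γA l) (wvA l) Λ ⊆ box 2 7)
    (gA : Fin nSA → β → α)
    (hgA : ∀ l b, d (gA l b) = Orb.embMap (PolySite.incl (hshA l)) (Orb.embMap (PolySite.d4Emb (γA l) (wvA l) Λ) (dΛ b)))
    (SYA : Fin nSA → Terms β) (CWA : Terms α) (hcwA : ∀ wc ∈ CWA, chargeW wc.1 ≠ 0 ∨ spinChargeW sp wc.1 ≠ 0) (AVA : List (Terms α))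
    {RA : CARPoly.Poly α}
    (hRA : evalPoly d RA = termOp d (residTG TXA μA νA o κA capA κA' flA TEA TGA THA f EB gA SYA CWA AVA))
    {βA : ℚ} (hβA : βA ≤ lowerConst RA + (μA 0 + μA 1) * (n₀ / 2 - νA))
    -- vertex B
    (THB : Terms α) (hHB : termOp d THB = (hubbardTTPrimeFermionInteraction 1 (sB : ℝ) (U : ℝ)).localHamiltonian (box 2 7))
    (TEB : Terms α)
    (hEB : termOp d TEB = fermionEmbed (PolySite.incl h0) ((hubbardTTPrimeFermionInteraction 1 (sB : ℝ) (U : ℝ)).meanEnergyObs 1))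
    (TXB : Terms α) (hXB : termOp d TXB = X (sB : ℝ)) (μB : Fin 2 → ℚ) (νB κB capB κB' flB : ℚ)
    (TGB : Terms α) {mB : Type*} [Fintype mB] [DecidableEq mB] {ΛmB : Matrix mB mB ℂ} (hΛmB : ΛmB.PosSemidef)
    (OB : mB → FermionOp (box 2 7)) (hGB : termOp d TGB = gramForm ΛmB OB)
    {nSB : ℕ} (γB : Fin nSB → DihedralGroup 4) (wvB : Fin nSB → Site 2) (hshB : ∀ l, d4ShiftSet (γB l) (wvB l) Λ ⊆ box 2 7)
    (gB : Fin nSB → β → α)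
    (hgB : ∀ l b, d (gB l b) = Orb.embMap (PolySite.incl (hshB l)) (Orb.embMap (PolySite.d4Emb (γB l) (wvB l) Λ) (dΛ b)))
    (SYB : Fin nSB → Terms β) (CWB : Terms α) (hcwB : ∀ wc ∈ CWB, chargeW wc.1 ≠ 0 ∨ spinChargeW sp wc.1 ≠ 0) (AVB : List (Terms α))
    {RB : CARPoly.Poly α}
    (hRB : evalPoly d RB = termOp d (residTG TXB μB νB o κB capB κB' flB TEB TGB THB f EB gB SYB CWB AVB))
    {βB : ℚ} (hβB : βB ≤ lowerConst RB + (μB 0 + μB 1) * (n₀ / 2 - νB)) :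
    SquareTTPrimePinnedPairRowT (U : ℝ) (n₀ : ℝ) (sA : ℝ) (sB : ℝ) capA capB flA flB βA κA κA' βB κB κB' X := by
  have hUr : (0 : ℝ) ≤ ((U : ℚ) : ℝ) := by exact_mod_cast hU
  have hn0r : (0 : ℝ) ≤ ((n₀ : ℚ) : ℝ) := by exact_mod_cast hn0
  have hn2r : ((n₀ : ℚ) : ℝ) < 2 := by exact_mod_cast hn2
  -- (1) the two window identities from the semantic residuals, on the objectives `X sA`, `X sB`
  have hcertA := CARPolyWindow.windowIdentity_of_residPoly hΛ hz d dΛ f hf THA _ hHA TEA _ hEA o ho TXA μA νA κA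
    capA κA' flA TGA ΛmA OA hGA EB γA wvA hshA gA hgA SYA CWA AVA hRA
  rw [hXA] at hcertA
  have hcertB := CARPolyWindow.windowIdentity_of_residPoly hΛ hz d dΛ f hf THB _ hHB TEB _ hEB o ho TXB μB νB κB
    capB κB' flB TGB ΛmB OB hGB EB γB wvB hshB gB hgB SYB CWB AVB hRB
  rw [hXB] at hcertB
  -- (2) the charged words are charged (decided on the syntax)
  have hcwA' := CARPolyWindow.charged_of_hcw d sp hsp CWA hcwA
  have hcwB' := CARPolyWindow.charged_of_hcw d sp hsp CWB hcwB
  -- (3) the prices are the engine's `lowerConst`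
  have hβA' : ((βA : ℚ) : ℝ) ≤ ((constCoeff RA : ℚ) : ℝ) - ∑ k ∈ (Finset.univ : Finset (Fin RA.length)), ‖resCoeff RA k‖ +
      (∑ σ : Fin 2, ((μA σ : ℚ) : ℝ)) * (((n₀ : ℚ) : ℝ) / 2 - ((νA : ℚ) : ℝ)) := by
    rw [constCoeff_sub_sum_norm_resCoeff RA, Fin.sum_univ_two]
    have h2 : ((βA : ℚ) : ℝ) ≤ (((lowerConst RA + (μA 0 + μA 1) * (n₀ / 2 - νA) : ℚ)) : ℝ) := by exact_mod_cast hβA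
    push_cast at h2
    linarith
  have hβB' : ((βB : ℚ) : ℝ) ≤ ((constCoeff RB : ℚ) : ℝ) - ∑ k ∈ (Finset.univ : Finset (Fin RB.length)), ‖resCoeff RB k‖ +
      (∑ σ : Fin 2, ((μB σ : ℚ) : ℝ)) * (((n₀ : ℚ) : ℝ) / 2 - ((νB : ℚ) : ℝ)) := by
    rw [constCoeff_sub_sum_norm_resCoeff RB, Fin.sum_univ_two]
    have h2 : ((βB : ℚ) : ℝ) ≤ (((lowerConst RB + (μB 0 + μB 1) * (n₀ / 2 - νB) : ℚ)) : ℝ) := by exact_mod_cast hβB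
    push_cast at h2
    linarith
  -- (4) the identity-level pair theorem, with the SHARED eom words `B_k := termOp dΛ (EB.get k)`
  exact SquareTTPrimePinnedPairRowT.of_windowIdentities hUr hn0r hn2r (sA : ℝ) (sB : ℝ) hΛ h8 h0 hz X
    (Finset.univ : Finset (Fin EB.length)) (fun k => termOp dΛ (EB.get k))
    (fun σ => ((μA σ : ℚ) : ℝ)) ((νA : ℚ) : ℝ) capA flA κA κA' hΛmA OA Finset.univ γA wvA hshA (fun l => termOp dΛ (SYA l))
    Finset.univ (fun j => (((CWA.get j).2 : ℚ) : ℂ)) (fun j => wmap d (CWA.get j).1) hcwA' Finset.univ (fun _ => (1 : ℝ))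
    (fun m' => termOp d (AVA.get m')) Finset.univ (resCoeff RA) (resWord d RA) hcertA hβA'
    (fun σ => ((μB σ : ℚ) : ℝ)) ((νB : ℚ) : ℝ) capB flB κB κB' hΛmB OB Finset.univ γB wvB hshB (fun l => termOp dΛ (SYB l))
    Finset.univ (fun j => (((CWB.get j).2 : ℚ) : ℂ)) (fun j => wmap d (CWB.get j).1) hcwB' Finset.univ (fun _ => (1 : ℝ))
    (fun m' => termOp d (AVB.get m')) Finset.univ (resCoeff RB) (resWord d RB) hcertB hβB'

end KernelPairPoly


end Summit.Ventures.CertifiedManyBodySolver.Downfold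

end
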